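import Literature.AnabelianGeometry.EtaleTheta.Discharge.Sec5Prop53Labels
import Mathlib.Algebra.Group.Submonoid.Membership

/-!
# [EtTh] §5, Proposition 5.3 (ii), (iii), (v): "monoid type `ℤ`" from the factorization data (pp. 325–327 / PDF pp. 99–101)

Mochizuki, *The étale theta function …*, Publ. RIMS **45** (2009)
[cite: MochizukiEtTh2009, Prop 5.3 p.325 (PDF p.99); Def 3.6 (i) p.302 (PDF p.76)].  Seat abc-iut-L2-d4 (merge row
W3-L2-03, second proof companion); PROOF-ONLY over this seat's `FrobenioidThetaDivisorSupport.lean`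
(`DivisorSupportData`) and `Discharge/Sec5Prop53.lean` / `Discharge/Sec5Prop53Labels.lean`.

The hypothesis "`C` is of monoid type `ℤ`" of this seat's Prop. 5.3 (ii)/(iii)/(v) discharges — every primary
component `Φ(A_⊚)_𝔭` a copy of `ℤ_{≥0}` (`hN : Nonempty (𝔭.submonoid ≃* Multiplicative ℕ)`) — is a THEOREM for data
carrying a `DivisorSupportData`: `Φ(A_⊚)_𝔭` is the monoid of powers of the prime log-divisor `gen_𝔭`
(`submonoid_eq_powers`), on which the exponent is injective (`gen_pow_injective`), so it is `ℤ_{≥0}`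
(`monoidTypeZ`).  Hence Prop. 5.3 (ii), (iii) hold for such data outright (`preservesNcspComponentIsos_of_supportData`,
`preservesCspComponentIsos_of_supportData`) and Prop. 5.3 (v) modulo (i) on primes, F1-Ψ and the printed adjacency
criterion only (`preservesNcspLabels_of_supportData`).
HONEST FRAMING: kernel-checked consequences of the typed data; typed ≠ discharged; no side taken on anything
downstream. -/

namespace Literature.AnabelianGeometry.EtaleTheta

open CategoryTheory
open Literature.AlgebraicGeometry.Frobenioids

universe w v v' u u'

namespace FrobenioidThetaDivisors

namespace DivisorSupportData

variable {C : Type u} [Category.{v} C] {D : Type u'} [Category.{v'} D] {𝔉 : ThetaFrobenioid.{w} C D}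
  {𝔓 : DivisorPrimeData 𝔉} (𝔖 : DivisorSupportData 𝔓)

/-- **`Φ(A_⊚)_𝔭` is the monoid of powers of the prime log-divisor `gen_𝔭`** ([FrdI] §0: `M_𝔭` is the submonoid
generated by the primary elements of `𝔭`; these are the positive powers of `gen_𝔭`, `factor_carrier`).
[cite: MochizukiEtTh2009, Prop 5.3 p.325 (PDF p.99)] -/
theorem submonoid_eq_powers (𝔭 : Primes 𝔉.PhiAcirc) : 𝔭.submonoid = Submonoid.powers (𝔖.gen 𝔭) := by
  apply le_antisymm
  · refine Submonoid.closure_le.mpr fun a ha => ?_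
    obtain ⟨n, -, rfl⟩ := 𝔖.eq_gen_pow_of_mem_carrier ha
    exact ⟨n, rfl⟩
  · rw [Submonoid.powers_eq_closure]
    exact Submonoid.closure_le.mpr (Set.singleton_subset_iff.mpr (Submonoid.subset_closure (𝔖.gen_mem_carrier 𝔭)))

/-- The exponent of a power of `gen_𝔭` is determined (`factor(gen_𝔭^n) = n·[𝔭]`, `factor` injective).
[cite: MochizukiEtTh2009, Prop 5.3 p.325 (PDF p.99)] -/
theorem gen_pow_injective (𝔭 : Primes 𝔉.PhiAcirc) : Function.Injective fun n : ℕ => 𝔖.gen 𝔭 ^ n := by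
  intro m n h
  have := congrArg (fun x => Multiplicative.toAdd (𝔖.factor x) 𝔭) h
  simp only [factor_gen_pow, toAdd_ofAdd, Finsupp.single_eq_same] at this
  exact_mod_cast this

include 𝔖 in
/-- **"`C` is of monoid type `ℤ`" for data carrying a `DivisorSupportData`**: every primary component
`Φ(A_⊚)_𝔭` is isomorphic to `ℤ_{≥0}` ([EtTh] Def. 3.6 (i); the hypothesis `hN` of `Sec5Prop53`).
[cite: MochizukiEtTh2009, Def 3.6 (i) p.302 (PDF p.76); Prop 5.3 p.325 (PDF p.99)] -/
theorem monoidTypeZ (𝔭 : Primes 𝔉.PhiAcirc) : Nonempty (𝔭.submonoid ≃* Multiplicative ℕ) := by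
  classical
  exact ⟨(MulEquiv.submonoidCongr (𝔖.submonoid_eq_powers 𝔭)).trans
    (Submonoid.powLogEquiv (𝔖.gen_pow_injective 𝔭)).symm⟩

end DivisorSupportData

section Prop53

variable {C : Type u} [Category.{v} C] {D : Type u'} [Category.{v'} D] {𝔉 : ThetaFrobenioid.{w} C D}
  {𝔓 : DivisorPrimeData 𝔉} (𝔖 : DivisorSupportData 𝔓) (Ψ : C ≌ C) (ι : Ψ.functor.obj 𝔉.Acirc ≅ 𝔉.Acirc)
  (e : 𝔉.PhiAcirc ≃* 𝔉.pre.Mon (𝔉.base.obj (Ψ.functor.obj 𝔉.Acirc)))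

include 𝔖 in
/-- **[EtTh] Proposition 5.3 (ii) for data carrying a `DivisorSupportData`** (monoid type `ℤ` is then a theorem):
`Ψ^Φ_{A_⊚}` is compatible with the natural isomorphisms between non-cuspidal primary components — given only
(i) on primes.  [cite: MochizukiEtTh2009, Prop 5.3 (ii) p.325 (PDF p.99)] -/
theorem preservesNcspComponentIsos_of_supportData (hc : CuspPreserved 𝔓 Ψ ι e) :
    PreservesNcspComponentIsos 𝔓 Ψ ι e hc :=
  preservesNcspComponentIsos_of_monoidTypeZ 𝔓 Ψ ι e hc 𝔖.monoidTypeZ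

include 𝔖 in
/-- **[EtTh] Proposition 5.3 (iii) for data carrying a `DivisorSupportData`**: `Ψ^Φ_{A_⊚}` is compatible with the
natural isomorphisms between cuspidal primary components — given only (i) on primes.
[cite: MochizukiEtTh2009, Prop 5.3 (iii) p.325 (PDF p.99)] -/
theorem preservesCspComponentIsos_of_supportData (hc : CuspPreserved 𝔓 Ψ ι e) :
    PreservesCspComponentIsos 𝔓 Ψ ι e hc :=
  preservesCspComponentIsos_of_monoidTypeZ 𝔓 Ψ ι e hc 𝔖.monoidTypeZ

/-- **[EtTh] Proposition 5.3 (v) for data carrying a `DivisorSupportData`**, modulo (i) on primes, F1-Ψ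
("`Ψ^Φ` preserves the image of the birational function monoid", [FrdI] Thm. 4.9 / Cor. 4.10) and the printed
adjacency criterion (pp.326–327) ONLY — monoid type `ℤ` being a theorem.
[cite: MochizukiEtTh2009, Prop 5.3 (v) p.325 (PDF p.99); proof p.327 (PDF p.101)] -/
theorem preservesNcspLabels_of_supportData (hc : CuspPreserved 𝔓 Ψ ι e)
    (hP : ∀ x, ThetaFrobenioid.gpMap (psiPhi 𝔉 Ψ ι e).toMonoidHom x ∈ 𝔖.principal ↔ x ∈ 𝔖.principal)
    (hAdj : AdjacencyCriterion 𝔖) : PreservesNcspLabels 𝔓 Ψ ι e hc :=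
  preservesNcspLabels_of_adjacencyCriterion 𝔖 Ψ ι e hc 𝔖.monoidTypeZ hP hAdj

end Prop53

end FrobenioidThetaDivisors

end Literature.AnabelianGeometry.EtaleTheta
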